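import Mathlib
import Summits.Ventures.PercRepro2.ZMeanProof
import Summits.Ventures.PercRepro2.PocketConn
import Summits.Ventures.PercRepro2.PocketRowT
import Summits.Ventures.PercRepro2.PocketSign

/-!
# (HCOV) whenever the root pair separates `a₃` from the markers

The intrinsic form of the root-only-pocket theorem: let `sepComp` be the connected component of
`a₃` in the graph with every edge at `a₁` or `a₂` removed (all other edges open).  It is a
root-only pocket (`isPocket_sepComp`), so if it contains neither `o` nor `b` — i.e. `{a₁, a₂}`
separates `a₃` from `{o, b}` — then `(HMF)` and `(HCOV)` hold (`HMF_of_separated`,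
`HCov_of_separated`).
-/

namespace Summit.Ventures.PercRepro2

namespace PocketConn

variable {V : Type*} {E : Type*} [Fintype V] [DecidableEq V]

/-- The component of `a₃` in `G − {a₁, a₂}`: the vertices reachable from `a₃` with every edge
touching a root closed and every other edge open. -/
def sepComp (ends : E → Sym2 V) (a₁ a₂ a₃ : V) : Set V :=
  cluster ends (restrict (touches ends (↑({a₁, a₂} : Finset V) : Set V))ᶜ (fun _ => true)) a₃

variable {ends : E → Sym2 V} {a₁ a₂ a₃ : V}

/-- Vertices of the component are not roots. -/
lemma not_root_of_mem_sepComp (h31 : a₃ ≠ a₁) (h32 : a₃ ≠ a₂) {x : V}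
    (hx : x ∈ sepComp ends a₁ a₂ a₃) : x ∉ (↑({a₁, a₂} : Finset V) : Set V) := by
  have h3 : a₃ ∉ (↑({a₁, a₂} : Finset V) : Set V) := by
    simp [h31, h32]
  exact not_mem_of_conn_restrict_compl h3 hx

/-- The component is a root-only pocket. -/
lemma isPocket_sepComp (h31 : a₃ ≠ a₁) (h32 : a₃ ≠ a₂) :
    IsPocket ends (sepComp ends a₁ a₂ a₃) a₁ a₂ := by
  intro e x y hxy hx
  by_cases hy : y = a₁ ∨ y = a₂
  · exact Or.inr hy
  · left
    have hy' : y ∉ (↑({a₁, a₂} : Finset V) : Set V) := by simpa [not_or] using hy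
    have hx' := not_root_of_mem_sepComp h31 h32 hx
    have hopen : OpenAdj ends
        (restrict (touches ends (↑({a₁, a₂} : Finset V) : Set V))ᶜ (fun _ => true)) x y :=
      openAdj_restrict_compl (by rfl) hxy hx' hy'
    exact conn_trans hx (conn_of_openAdj hopen)


/-- The component of `a₃` is contained in every root-only pocket containing `a₃`. -/
lemma sepComp_subset_of_isPocket {S : Set V} (hS : IsPocket ends S a₁ a₂) (h3 : a₃ ∈ S) :
    sepComp ends a₁ a₂ a₃ ⊆ S := by
  intro x hx
  have key : x ∈ {z | z ∈ S} := by
    refine mem_of_conn_of_closed (ends := ends)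
      (ω := restrict (touches ends (↑({a₁, a₂} : Finset V) : Set V))ᶜ (fun _ => true)) ?_ h3 hx
    rintro z hz w hzw
    obtain ⟨_, e, he, hends⟩ := openGraph_adj.1 hzw
    simp only [Set.mem_setOf_eq] at hz ⊢
    have hw : w ∉ (↑({a₁, a₂} : Finset V) : Set V) := fun hw =>
      (restrict_eq_true_iff.1 he).2 (mem_touches_of_ends hends (Or.inr hw))
    rcases hS e z w hends hz with hwS | rfl | rfl
    · exact hwS
    · exact absurd (by simp) hw
    · exact absurd (by simp) hw
  exact key

/-- `a₃` lies in its component. -/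
lemma mem_sepComp_self : a₃ ∈ sepComp ends a₁ a₂ a₃ := conn_refl _ _ _

section Main

variable [Fintype E] [DecidableEq E] {R : Type*} [Field R] [LinearOrder R] [IsStrictOrderedRing R]

/-- **(HMF) whenever `{a₁, a₂}` separates `a₃` from `{o, b}`.** -/
theorem HMF_of_separated (p : E → R) (hp : IsProbVec p) (h12 : a₁ ≠ a₂) (h31 : a₃ ≠ a₁)
    (h32 : a₃ ≠ a₂) {o b : V} (ho : o ∉ sepComp ends a₁ a₂ a₃) (hb : b ∉ sepComp ends a₁ a₂ a₃) :
    HMF p ends o a₁ a₂ a₃ b := by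
  classical
  have hP : IsPocket ends (↑(sepComp ends a₁ a₂ a₃).toFinset : Set V) a₁ a₂ := by
    rw [Set.coe_toFinset]
    exact isPocket_sepComp h31 h32
  refine HMF_pocket p hp hP h12 ?_ ?_ ?_ ?_ ?_
  · intro h
    exact not_root_of_mem_sepComp h31 h32 (Set.mem_toFinset.1 h) (by simp)
  · intro h
    exact not_root_of_mem_sepComp h31 h32 (Set.mem_toFinset.1 h) (by simp)
  · exact fun h => ho (Set.mem_toFinset.1 h)
  · exact fun h => hb (Set.mem_toFinset.1 h)
  · exact Set.mem_toFinset.2 mem_sepComp_self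

/-- **(HCOV) whenever `{a₁, a₂}` separates `a₃` from `{o, b}`.** -/
theorem HCov_of_separated (p : E → R) (hp : IsProbVec p) (h12 : a₁ ≠ a₂) (h31 : a₃ ≠ a₁)
    (h32 : a₃ ≠ a₂) {o b : V} (ho : o ∉ sepComp ends a₁ a₂ a₃) (hb : b ∉ sepComp ends a₁ a₂ a₃) :
    CovForm.HCov p ends o a₁ a₂ a₃ b :=
  HCov_of_HMF p hp ends o a₁ a₂ a₃ b (HMF_of_separated p hp h12 h31 h32 ho hb)

/-- **Every edge at `a₃` ends at a root ⇒ (HCOV)** (pendant root, two roots, parallel root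
edges, …): the component of `a₃` is `{a₃}`. -/
theorem HCov_of_edges_to_roots (p : E → R) (hp : IsProbVec p) (h12 : a₁ ≠ a₂) (h31 : a₃ ≠ a₁)
    (h32 : a₃ ≠ a₂) (hleaf : ∀ e x, ends e = s(a₃, x) → x = a₁ ∨ x = a₂) {o b : V} (ho : o ≠ a₃)
    (hb : b ≠ a₃) : CovForm.HCov p ends o a₁ a₂ a₃ b := by
  have hS : IsPocket ends ({a₃} : Set V) a₁ a₂ := by
    intro e x y hxy hx
    rw [Set.mem_singleton_iff] at hx
    subst hx
    exact Or.inr (hleaf e y hxy)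
  have hsub := sepComp_subset_of_isPocket hS (Set.mem_singleton a₃)
  refine HCov_of_separated p hp h12 h31 h32 ?_ ?_
  · exact fun h => ho (Set.mem_singleton_iff.1 (hsub h))
  · exact fun h => hb (Set.mem_singleton_iff.1 (hsub h))

/-- **The pocket `{u, a₃}`** (every edge at `u` ends in `{a₁, a₂, a₃}` and every edge at `a₃` in
`{a₁, a₂, u}`) ⇒ (HCOV): subsumes the pendant-at-a-star case `HMFStarLeaf.HCov_star_leaf` with
no leaf, degree or multiplicity hypotheses. -/
theorem HCov_of_pocket_pair (p : E → R) (hp : IsProbVec p) (h12 : a₁ ≠ a₂) (h31 : a₃ ≠ a₁)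
    (h32 : a₃ ≠ a₂) {u : V} (hu : ∀ e x, ends e = s(u, x) → x = a₁ ∨ x = a₂ ∨ x = a₃)
    (h3 : ∀ e x, ends e = s(a₃, x) → x = a₁ ∨ x = a₂ ∨ x = u) {o b : V} (ho3 : o ≠ a₃)
    (hou : o ≠ u) (hb3 : b ≠ a₃) (hbu : b ≠ u) : CovForm.HCov p ends o a₁ a₂ a₃ b := by
  have hS : IsPocket ends ({u, a₃} : Set V) a₁ a₂ := by
    intro e x y hxy hx
    simp only [Set.mem_insert_iff, Set.mem_singleton_iff] at hx ⊢
    rcases hx with rfl | rfl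
    · rcases hu e y hxy with h | h | h
      · exact Or.inr (Or.inl h)
      · exact Or.inr (Or.inr h)
      · exact Or.inl (Or.inr h)
    · rcases h3 e y hxy with h | h | h
      · exact Or.inr (Or.inl h)
      · exact Or.inr (Or.inr h)
      · exact Or.inl (Or.inl h)
  have hsub := sepComp_subset_of_isPocket (a₃ := a₃) hS
    (Set.mem_insert_of_mem _ (Set.mem_singleton a₃))
  refine HCov_of_separated p hp h12 h31 h32 ?_ ?_
  · intro h
    rcases hsub h with h' | h'
    · exact hou h'
    · exact ho3 h'
  · intro h
    rcases hsub h with h' | h'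
    · exact hbu h'
    · exact hb3 h'

end Main

end PocketConn

end Summit.Ventures.PercRepro2
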